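/-
Copyright (c) 2026 the pub-hodgecm-mathlib formalisation cell (harness21).  Prover seat hodgecm-mathlib-LH4-p10 (g2), req620 Track A «(D-RAM) FOUR-FRAME» squad
(MS ROAD A, Stage B lead; B10 FINAL of skeleton `B10-StableCountTypeZero.SKELETON.v1` c61f53438acbd4dd — the assembly over the squad's ★ bricks).  2026-09-04.
-/
import Summits.HodgeConjecture.HodgeConjecture.Theorems.F0P3cDyRamStrataPartition                -- ★ B10 PART 1 (this seat) p855987
import Summits.HodgeConjecture.HodgeConjecture.Theorems.F0P3cDyRamStableCountBoxReindexTypes      -- ★ B10 PART 2 FILE 3 (LH4-p14 (g2)): `sum_box_mul_eq_typeZero`; brings ★ FILES 1–2, ★ B8 + adapters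
import Summits.HodgeConjecture.HodgeConjecture.Theorems.F0P3cDyRamDiagonalStrataShapes            -- ★ B3 (LH4-p04 (g2)): `hasAxis_shapes`; brings ★ StrataAxis `exists_hasAxis`, `hasAxis_unique`
import Summits.HodgeConjecture.HodgeConjecture.Theorems.F0P3cDyRamDiagonalSplitCountSockets       -- ★ B4 (LH4-p13 (g2)): core ∕ T1 ∕ T2 ∕ T3 sockets
import Summits.HodgeConjecture.HodgeConjecture.Theorems.F0P3cDyRamDiagonalPermutation             -- ★ §P (LH4-p13 (g2)): `finsum_stabiliserWeight_stratum_G2_of_G1`, `…_G3_of_G1`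
import Summits.HodgeConjecture.HodgeConjecture.Theorems.F0P3cDyRamDiagonalGluedSocket             -- ★ B56 socket (LH4-p08 (g2)): `finsum_stabiliserWeight_hasAxis_G1`; brings ★ B5 (i)–(iv), ★ B6, ★ F1 (F0P3-p01 (g31))
import Summits.HodgeConjecture.HodgeConjecture.Theorems.F0P3cDyRamDiagonalCoreHangingSocket       -- ★ B7 socket (LH4-p07 (g3)): `finsum_stabiliserWeight_hasAxis_H`; brings ★ B7 (A)–(D2)
import Summits.HodgeConjecture.HodgeConjecture.Theorems.F0P3cDyRamElementDatumParity              -- ★ (this seat) p855966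
import Summits.HodgeConjecture.HodgeConjecture.Theorems.F0P3cDyRamDiagonalStableLatticesFinite    -- ★ `finite_setOf_normalised_diagonal_fixed_latt`
import Literature.NumberTheory.Automorphic.UnitaryThreeFourFrameFixedCosetDictionary             -- ★ `v_eq_one_of_mul_map_eq_one`
import HarnessLib

/-!
# Crux `H413`, MS ROAD A, STAGE B — B10 «THE TYPE-0 STABLE COUNT»: `Σᶠ_{M ∈ 𝓛₀(T), dualisable} 1∕[𝒰_F : S_F(M)] = (q^k − 1)∕(q − 1)`

Cell `hodgecm-mathlib` (D-0151), FLOOR 0, crux item H413 = `stmt-HodgeConjecture-24833`, route of record `HCCMUnconditional`; lane `--supports stmt-HodgeConjecture-24833 --as helper`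
(count-neutral).  THEOREMS ONLY (no `def`, no instance, no notation, no `sorry`).  This file is the `hB10` binder of ★ p856175 `F0P3cDyRamStableModelSumOfStageB.stableModelSum_of_stageB`
(the MS sentence `stub_U3_stableModelSum` modulo Stage B), head `finsum_stabiliserWeight_dualisable_eq` = skeleton c61f53438acbd4dd VERBATIM.

THE MATHEMATICS (LH4-p10 MEMO-stableLaw-finite v2 §B).  Behind the dyadic fence, at a ramified quadratic datum `(σ, ϖ; d, t)` and an element datum `(α, β; n₁, n₂, n₃)` above the
datum depth, the weighted number of `U_F`-classes of self-dual-isable normalised `T = diag(α, β, 1)`-stable lattices is the `q`-bracket `[k]_q`, `2k + d = n₁ + n₂ + n₃ + 2`.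
Proof = CLASS-BY-CLASS CENSUS indexed by the AXIS VECTOR `a(M)` (`M ∩ K·eᵢ = 𝔭^{aᵢ}eᵢ`):
1. `𝓛₀(T)` is finite (★ `finite_setOf_normalised_diagonal_fixed_latt`); every member has a unique axis vector in the box `[0, n₁+n₂+n₃]³` (★ B3-α `exists_hasAxis`, ★ `hasAxis_unique`),
   so the sum splits over the box into the strata `stratum σ ϖ T a` (★ PART 1 `finsum_mem_eq_sum_box_finsum_mem_hasAxis`, ★ `mem_stratum_iff`).
2. Each stratum carries the Stage-B table: core `1` (★ B4 `finsum_stabiliserWeight_hasAxis_core`), on-branch `T₁∕T₂∕T₃(s)` = `q^{s∕2}·[2∣s, s ≤ nᵢ]` (★ B4 sockets), glued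
   `G₁(ρ,s)` = tube `(q−1)q^{2ρ+s∕2−1}` + glue shell at the special foot (★ B56 socket `finsum_stabiliserWeight_hasAxis_G1`), `G₂∕G₃` by the coordinate permutations (★ §P
   `finsum_stabiliserWeight_stratum_G2_of_G1`, `…_G3_of_G1`), core-hanging `H(ρ)` = `(q−2)q^{2ρ−1}` + equilateral glue (★ B7 socket `finsum_stabiliserWeight_hasAxis_H`), and `0` on
   every axis vector off the ★ B3-γ shape list `hasAxis_shapes` (empty stratum).
3. ★ PART 2 `sum_box_mul_eq_typeZero` (LH4-p14 (g2)) re-indexes the box sum into ★ B8's per-plane class sum and applies the law `(q−1)·Σ = q^k − 1`; the side conditions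
   (`nᵢ ≡ d (mod 2)`, isoceles key, `d ≤ min nᵢ`) are ★ `F0P3cDyRamElementDatumParity`; divide by `q − 1 ≠ 0`.
* `v_diag_eq_one`, `diag_regular`, `finite_normalisedStableLattices` — the eigenvalue vector is a regular unit diagonal; `𝓛₀(T)` is finite.
* `finsum_stabiliserWeight_stratum_eq_zero_of_not_shape` — strata off the shape list weigh `0`.
* `finsum_stabiliserWeight_dualisable_eq` — HEAD (B10).
HONEST LABEL.  Count-neutral; `HC_CM` is proved only modulo the 7 printed citations (2 remaining named inputs: hLiu418 = `stmt-HodgeConjecture-24832`, h413 = `stmt-HodgeConjecture-24833`) until rung 0 closes.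

## References
* [Kottwitz1986BaseChangeUnits] R. Kottwitz, *Base change for unit elements of Hecke algebras*, Compositio Math. 60 (1986), §1 pp. 240–241 (counting fixed lattices by position).
* [Rogawski1990] J. Rogawski, *Automorphic representations of unitary groups in three variables*, Ann. of Math. Stud. 123 (1990), §4.9 Prop. 4.9.1 (a) p. 55 (the stable count).
-/

set_option autoImplicit false

noncomputable section

namespace Summit.HodgeConjecture.HodgeConjecture.Cruxes.H413.F0P3cDyRamStableCountTypeZero

open Finset
open Literature.NumberTheory.Automorphic Literature.NumberTheory.Automorphic.HermitianLattice
open Literature.NumberTheory.Automorphic.UnitaryLatticeTree Literature.NumberTheory.Automorphic.UnitaryThreeFourFrame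
open Summit.HodgeConjecture.HodgeConjecture.Cruxes.H413.F0P3cDyRamDiagonalTorusDefs
open Summit.HodgeConjecture.HodgeConjecture.Cruxes.H413.F0P3cDyRamDiagonalStrataDefs
open Summit.HodgeConjecture.HodgeConjecture.Cruxes.H413.F0P3cDyRamStrataPartition (finsum_mem_eq_sum_box_finsum_mem_hasAxis)
open Summit.HodgeConjecture.HodgeConjecture.Cruxes.H413.F0P3cDyRamDiagonalStrataAxis (exists_hasAxis hasAxis_unique)
open Summit.HodgeConjecture.HodgeConjecture.Cruxes.H413.F0P3cDyRamDiagonalStrataShapes (hasAxis_shapes)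
open Summit.HodgeConjecture.HodgeConjecture.Cruxes.H413.F0P3cDyRamDiagonalSplitCountSockets
open Summit.HodgeConjecture.HodgeConjecture.Cruxes.H413.F0P3cDyRamDiagonalPermutation
open Summit.HodgeConjecture.HodgeConjecture.Cruxes.H413.F0P3cDyRamDiagonalGluedSocket (finsum_stabiliserWeight_hasAxis_G1)
open Summit.HodgeConjecture.HodgeConjecture.Cruxes.H413.F0P3cDyRamDiagonalCoreHangingSocket (finsum_stabiliserWeight_hasAxis_H)
open Summit.HodgeConjecture.HodgeConjecture.Cruxes.H413.F0P3cDyRamElementDatumParity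
open Summit.HodgeConjecture.HodgeConjecture.Cruxes.H413.F0P3cDyRamDiagonalStableLatticesFinite (finite_setOf_normalised_diagonal_fixed_latt)
open Summit.HodgeConjecture.HodgeConjecture.Cruxes.H413.F0P3cDyRamStableCountBoxReindexTypes (sum_box_mul_eq_typeZero)
open scoped Valued WithZero Matrix MatrixGroups

/-! ## §1  Small facts about the datum -/

section Facts

variable {K : Type} [Field K] [Valued K ℤᵐ⁰]

/-- The eigenvalue vector `(α, β, 1)` of the element datum consists of units. [cite: Rogawski1990, §4.9 p. 55] -/
theorem v_diag_eq_one {σ : K →+* K} (hvσ : ∀ a, Valued.v (σ a) = Valued.v a) {ϖ : K} {α β : K} {N₀ n₁ n₂ n₃ : ℕ}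
    (hE : IsElementDatum σ ϖ N₀ α β n₁ n₂ n₃) : ∀ i : Fin 3, Valued.v ((![α, β, 1] : Fin 3 → K) i) = 1 := by
  obtain ⟨hα, hβ, -⟩ := hE
  intro i
  fin_cases i
  · exact UnitaryThreeFourFrame.v_eq_one_of_mul_map_eq_one hvσ hα
  · exact UnitaryThreeFourFrame.v_eq_one_of_mul_map_eq_one hvσ hβ
  · exact map_one _

/-- The eigenvalue vector `(α, β, 1)` of the element datum is regular (pairwise distinct entries). [cite: Rogawski1990, §4.9 p. 55] -/
theorem diag_regular {σ : K →+* K} {ϖ : K} {α β : K} {N₀ n₁ n₂ n₃ : ℕ} (hE : IsElementDatum σ ϖ N₀ α β n₁ n₂ n₃) :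
    ∀ i j : Fin 3, i ≠ j → (![α, β, 1] : Fin 3 → K) i ≠ (![α, β, 1] : Fin 3 → K) j := by
  obtain ⟨-, -, hαβ, hα1, hβ1, -⟩ := hE
  intro i j hij
  fin_cases i <;> fin_cases j
  all_goals first | exact absurd rfl hij | simpa using hαβ | simpa using hαβ.symm | simpa using hα1 | simpa using hα1.symm |
    simpa using hβ1 | simpa using hβ1.symm

/-- `𝓛₀(T)` is finite for the regular unit diagonal `T = diag(α, β, 1)`. [cite: Kottwitz1986BaseChangeUnits, §1 pp. 240–241] -/
theorem finite_normalisedStableLattices [Finite 𝓀[K]] {σ : K →+* K} {ϖ : K} {d t : ℕ} (hD : IsRamifiedQuadraticDatum σ ϖ d t)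
    {α β : K} {N₀ n₁ n₂ n₃ : ℕ} (hE : IsElementDatum σ ϖ N₀ α β n₁ n₂ n₃)
    (T : GL (Fin 3) K) (hT : (T : Matrix (Fin 3) (Fin 3) K) = Matrix.diagonal ![α, β, 1]) :
    (normalisedStableLattices T).Finite :=
  finite_setOf_normalised_diagonal_fixed_latt hD.2.2.1 _ (v_diag_eq_one hD.2.1 hE) (diag_regular hE) T hT

/-- The stratum of an axis vector OFF the B3 shape list is empty, hence carries weight `0`. [cite: Kottwitz1986BaseChangeUnits, §1 pp. 240–241] -/
theorem finsum_stabiliserWeight_stratum_eq_zero_of_not_shape {σ : K →+* K} {ϖ : K} {d t : ℕ} (hD : IsRamifiedQuadraticDatum σ ϖ d t)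
    (T : GL (Fin 3) K) (a : Fin 3 → ℕ)
    (ha : ¬ ((a = ![0, 0, 0]) ∨
      (∃ s, 2 ∣ s ∧ 2 ≤ s ∧ (a = ![0, s, s] ∨ a = ![s, 0, s] ∨ a = ![s, s, 0])) ∨
      (∃ ρ s, 1 ≤ ρ ∧ 2 ∣ s ∧ 2 ≤ s ∧ (a = ![2 * ρ, 2 * ρ + s, 2 * ρ + s] ∨ a = ![2 * ρ + s, 2 * ρ, 2 * ρ + s] ∨ a = ![2 * ρ + s, 2 * ρ + s, 2 * ρ])) ∨
      (∃ ρ, 1 ≤ ρ ∧ a = ![2 * ρ, 2 * ρ, 2 * ρ]))) :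
    ∑ᶠ M ∈ stratum σ ϖ T a, stabiliserWeight σ M = 0 := by
  have hempty : stratum σ ϖ T a = ∅ :=
    Set.eq_empty_of_forall_notMem fun M hM => by
      obtain ⟨hM₀, hdual, hax⟩ := (mem_stratum_iff σ ϖ T a M).1 hM
      exact ha (hasAxis_shapes hD hM₀ hdual hax)
  rw [hempty, finsum_mem_empty]

end Facts

/-! ## §2  HEAD — B10: the type-0 stable count -/

section Head

variable {K : Type} [Field K] [Valued K ℤᵐ⁰]

/-- **B10 · THE TYPE-0 STABLE COUNT.**  Behind the dyadic fence, at a ramified quadratic datum `(σ, ϖ; d, t)` and an element datum `(α, β; n₁, n₂, n₃)` above the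
datum depth (`d ≤ N₀`), with `T = diag(α, β, 1)` and the shift `2k + d = n₁ + n₂ + n₃ + 2`:
`Σᶠ_{M ∈ 𝓛₀(T), M dualisable} 1∕[𝒰_F : S_F(M)] = (q^k − 1)∕(q − 1)`, `q = #𝓀`.
ASSEMBLY: partition of the finite set `𝓛₀(T) ∩ {dualisable}` by the axis vector over the box `[0, n₁+n₂+n₃]³` (★ PART 1 `finsum_mem_eq_sum_box_finsum_mem_hasAxis`, ★ B3-α
`exists_hasAxis`, ★ `hasAxis_unique`); each cell is a stratum (★ `mem_stratum_iff`) whose weight is the Stage-B table — core ★ B4, on-branch ★ B4 T1∕T2∕T3, glued ★ B56 G1 and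
★ §P G2∕G3, core-hanging ★ B7 H — and `0` off the ★ B3-γ shape list; ★ PART 2 `sum_box_mul_eq_typeZero` re-indexes the box sum into ★ B8's per-plane class sum and applies the
law `(q − 1)·Σ = q^k − 1`; the parities `nᵢ ≡ d`, isoceles shape and `d ≤ min nᵢ` are ★ `F0P3cDyRamElementDatumParity`. [cite: Kottwitz1986BaseChangeUnits, §1 pp. 240–241]
[cite: Rogawski1990, §4.9 Prop. 4.9.1 (a) p. 55] -/
theorem finsum_stabiliserWeight_dualisable_eq [Fintype 𝓀[K]] {σ : K →+* K} {ϖ : K} {d t : ℕ} (hD : IsRamifiedQuadraticDatum σ ϖ d t)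
    (h2 : Valued.v (2 : K) < 1) {α β : K} {N₀ n₁ n₂ n₃ : ℕ} (hE : IsElementDatum σ ϖ N₀ α β n₁ n₂ n₃) (hN₀ : d ≤ N₀)
    (T : GL (Fin 3) K) (hT : (T : Matrix (Fin 3) (Fin 3) K) = Matrix.diagonal ![α, β, 1]) (k : ℕ) (hk : 2 * k + d = n₁ + n₂ + n₃ + 2) :
    ∑ᶠ M ∈ {M | M ∈ normalisedStableLattices T ∧ IsDualisableLattice σ ϖ M}, stabiliserWeight σ M =
      ((Fintype.card 𝓀[K] : ℚ) ^ k - 1) / ((Fintype.card 𝓀[K] : ℚ) - 1) := by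
  have hvσ : ∀ a, Valued.v (σ a) = Valued.v a := hD.2.1
  have hϖ : Valued.v ϖ = WithZero.exp (-1 : ℤ) := hD.2.2.1
  have hd : 1 ≤ d := hD.2.2.2.2.2.1
  -- (1) the summation set is finite and partitioned by axis vector over the box `[0, n₁+n₂+n₃]³`
  set S : Set (Submodule 𝒪[K] (Fin 3 → K)) := {M | M ∈ normalisedStableLattices T ∧ IsDualisableLattice σ ϖ M} with hS_def
  have hS : S.Finite := (finite_normalisedStableLattices hD hE T hT).subset fun M hM => hM.1
  have huniq : ∀ (M : Submodule 𝒪[K] (Fin 3 → K)) (a a' : Fin 3 → ℕ), HasAxis ϖ M a → HasAxis ϖ M a' → a = a' :=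
    fun M a a' ha ha' => hasAxis_unique hϖ ha ha'
  have haxis : ∀ M ∈ S, ∃ a : Fin 3 → ℕ, HasAxis ϖ M a ∧ ∀ i, a i ≤ n₁ + n₂ + n₃ :=
    fun M hM => exists_hasAxis hD hE hT hM.1
  rw [finsum_mem_eq_sum_box_finsum_mem_hasAxis huniq S hS (n₁ + n₂ + n₃) haxis]
  -- (2) each cell is a stratum
  have hcell : ∀ a : Fin 3 → ℕ, {M | M ∈ S ∧ HasAxis ϖ M a} = stratum σ ϖ T a := fun a => by
    ext M
    rw [mem_stratum_iff, Set.mem_setOf_eq, hS_def, Set.mem_setOf_eq, and_assoc]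
  simp_rw [hcell]
  -- (3) the Stage-B table, cell by cell, and the box re-index + law
  set q : ℕ := Fintype.card 𝓀[K] with hq_def
  obtain ⟨h1, h2', h3⟩ := depth_mod_two_eq_of_isElementDatum hD hE hN₀
  have key := sum_box_mul_eq_typeZero q hd (isoceles_of_isElementDatum hD hE) (le_min_depth_of_isElementDatum hE hN₀) h1 h2' h3 le_rfl hk
    (fun a => ∑ᶠ M ∈ stratum σ ϖ T a, stabiliserWeight σ M)
    (finsum_stabiliserWeight_hasAxis_core hD hE hT)
    (fun s hs => finsum_stabiliserWeight_hasAxis_T1 hD hE hT s hs)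
    (fun s hs => finsum_stabiliserWeight_hasAxis_T2 hD hE hT s hs)
    (fun s hs => finsum_stabiliserWeight_hasAxis_T3 hD hE hT s hs)
    (fun ρ s hρ hs => finsum_stabiliserWeight_hasAxis_G1 hD h2 hE hN₀ hT ρ s hρ hs)
    (fun ρ s hρ hs => ?_) (fun ρ s hρ hs => ?_)
    (fun ρ hρ => finsum_stabiliserWeight_hasAxis_H hD h2 hE hN₀ hT ρ hρ)
    (fun a ha => finsum_stabiliserWeight_stratum_eq_zero_of_not_shape hD T a ha)
  -- (4) divide by `q − 1 ≠ 0`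
  · have hq1 : (q : ℚ) - 1 ≠ 0 := by
      have : 1 < q := Fintype.one_lt_card
      have : (1 : ℚ) < q := by exact_mod_cast this
      linarith
    rw [eq_div_iff hq1, mul_comm]
    exact key
  -- the G2 cell from G1 by the swap `(0 1)`
  · exact finsum_stabiliserWeight_stratum_G2_of_G1 hE hT ρ s
      (fun m₁ m₂ m₃ => (if 2 ∣ s ∧ 2 * ρ ≤ min m₂ m₃ ∧ 2 * ρ + s ≤ m₁ then (((q : ℚ) - 1) * (q : ℚ) ^ (2 * ρ + s / 2 - 1)) else 0) +
        (if 2 ∣ s ∧ m₂ = m₃ ∧ m₁ = m₂ + s ∧ m₂ < 2 * ρ ∧ 2 * ρ - m₂ ≤ m₂ - d + 1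
          then ((q : ℚ) ^ (2 * ρ + s / 2 - (2 * ρ - m₂ + 1) / 2)) else 0))
      (fun T' hE' hT' => finsum_stabiliserWeight_hasAxis_G1 hD h2 hE' hN₀ hT' ρ s hρ hs)
  -- the G3 cell from G1 by the swap `(0 2)` and the rescaling by `α⁻¹`
  · have h := finsum_stabiliserWeight_stratum_G3_of_G1 hvσ hE hT ρ s
      (fun m₁ m₂ m₃ => (if 2 ∣ s ∧ 2 * ρ ≤ min m₂ m₃ ∧ 2 * ρ + s ≤ m₁ then (((q : ℚ) - 1) * (q : ℚ) ^ (2 * ρ + s / 2 - 1)) else 0) +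
        (if 2 ∣ s ∧ m₂ = m₃ ∧ m₁ = m₂ + s ∧ m₂ < 2 * ρ ∧ 2 * ρ - m₂ ≤ m₂ - d + 1
          then ((q : ℚ) ^ (2 * ρ + s / 2 - (2 * ρ - m₂ + 1) / 2)) else 0))
      (fun T' hE' hT' => finsum_stabiliserWeight_hasAxis_G1 hD h2 hE' hN₀ hT' ρ s hρ hs)
    rw [h, min_comm n₂ n₁]
    congr 1
    by_cases h12 : n₁ = n₂
    · subst h12
      simp only [true_and]
    · rw [if_neg (fun hc => h12 hc.2.1.symm), if_neg (fun hc => h12 hc.2.1)]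

end Head

end Summit.HodgeConjecture.HodgeConjecture.Cruxes.H413.F0P3cDyRamStableCountTypeZero

end
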